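import Summits.ResolutionOfSingularities.ResolutionOfSingularities.Theses.UniversalCells
import HarnessLib

/-!
# A non-reduced Γ-scheme with six columns (algebra for `IsIntegralLoadBearing`)

Support (negative) lemma material for crux stmt-ResolutionOfSingularities-15230
(`Summit.ResolutionOfSingularities.ResolutionOfSingularities.Theses.UniversalCells.MatroidCellRes`,
route UniversalCells), filed by the crux disprover (cdisprove seat); the scheme-theoretic conclusion
(`matroidCellRes_false_without_isIntegral`) is drawn in `Negative/IsIntegralLoadBearing.lean`.
This file declares no definition and no notation.

The Γ-ideal for `m = 3` and
`Γ₀ = {(c₀,c₁,c₂), (e₂,c₀,c₂), (e₁,e₂,c₂), (e₀,e₂,c₀), (e₀,e₁,c₁)}` is the span of `det A`,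
`a₀₀a₁₂ - a₀₂a₁₀`, `a₀₂`, `-a₁₀`, `a₂₁` (`minor_*`, `gammaIdeal_example_eq`). Write
`x = a₀₀, y = a₀₁, z = a₁₁, w = a₁₂, u = a₂₀, v = a₂₂` and `e₁ = a₀₂, e₂ = a₁₀, e₃ = a₂₁`; modulo the
entries the ideal is `(x w, x z v + y w u)`. FORMAL CONSEQUENCES of the five relations in any
commutative ring (integral polynomial identities, `ring`): `(y w u)² = 0` (`ywu_sq_eq_zero`),
`x² z v = 0`, `w² y u = 0` (`x_sq_zv_eq_zero`, `w_sq_yu_eq_zero`). Universal property of the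
stratum ring `S = (𝔽_p[A] ⧸ I)[(∏_∅)⁻¹]` (`exists_lift_stratumRing`, `ringHom_ext_stratumRing`).
Main algebraic statement `key_of_presentation`: for any ring `S` with a map `ι : 𝔽_p[A] → S`
killing the five minors through which all such maps factor uniquely, `f = ι(y w u)` is nilpotent,
`D(ι(y u z v))` is non-empty, and for every prime `𝔮 ∌ ι(y u z v)`, `s f = 0 ⇒ s ∈ 𝔮` — proved by
the TANGENT VECTOR `S → (S ⧸ 𝔮)[ε]`, `x ↦ ȳū ε`, `w ↦ -z̄v̄ ε`, `y, z, u, v ↦ ȳ, z̄, ū, v̄`,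
`e₁, e₂, e₃ ↦ 0`, which kills the relations, lies over `S → S ⧸ 𝔮` (because `x, w ∈ 𝔮`) and sends
`f` to `-ȳz̄v̄ū ε ≠ 0`. On `D(y u z v)` the Γ-scheme is `Spec 𝔽_p[y^±,u^±,z^±,v^±][x]/(x²)`.
Folklore throughout.
-/

noncomputable section

-- single-problem summit: the doubled namespace component `ResolutionOfSingularities` is forced
set_option linter.dupNamespace false

open CategoryTheory AlgebraicGeometry TopologicalSpace

namespace Summit.ResolutionOfSingularities.ResolutionOfSingularities.Theorems.MatroidCellRes.Negative

/-! ## §1 Formal consequences of the five relations (any commutative ring) -/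

/-- `(y w u)² = 0` follows from the five relations: `y w² u = w·(xzv + ywu) - zv·(xw)` and
`xzv + ywu = det A + e₃·xw + e₂·yv + e₁·(zu - e₂e₃)`. [folklore] -/
theorem ywu_sq_eq_zero {A : Type*} [CommRing A] (x y z w u v e₁ e₂ e₃ : A)
    (h1 : x * z * v - x * w * e₃ - y * e₂ * v + y * w * u + e₁ * e₂ * e₃ - e₁ * z * u = 0)
    (h2 : x * w - e₁ * e₂ = 0) (h3 : e₁ = 0) (h4 : e₂ = 0) (h5 : e₃ = 0) :
    (y * w * u) ^ 2 = 0 := by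
  subst h3 h4 h5
  have key : (y * w * u) ^ 2 =
      (y * u * w) * (x * z * v - x * w * 0 - y * 0 * v + y * w * u + 0 * 0 * 0 - 0 * z * u)
      + (-(y * u * z * v)) * (x * w - 0 * 0) := by ring
  rw [key, h1, h2]
  ring

/-- `x² z v = 0` follows from the five relations: `x·(xzv + ywu) - yu·(xw)`. [folklore] -/
theorem x_sq_zv_eq_zero {A : Type*} [CommRing A] (x y z w u v e₁ e₂ e₃ : A)
    (h1 : x * z * v - x * w * e₃ - y * e₂ * v + y * w * u + e₁ * e₂ * e₃ - e₁ * z * u = 0)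
    (h2 : x * w - e₁ * e₂ = 0) (h3 : e₁ = 0) (h4 : e₂ = 0) (h5 : e₃ = 0) :
    x ^ 2 * z * v = 0 := by
  subst h3 h4 h5
  have key : x ^ 2 * z * v =
      x * (x * z * v - x * w * 0 - y * 0 * v + y * w * u + 0 * 0 * 0 - 0 * z * u)
      + (-(y * u)) * (x * w - 0 * 0) := by ring
  rw [key, h1, h2]
  ring

/-- `w² y u = 0` follows from the five relations: `w·(xzv + ywu) - zv·(xw)`. [folklore] -/
theorem w_sq_yu_eq_zero {A : Type*} [CommRing A] (x y z w u v e₁ e₂ e₃ : A)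
    (h1 : x * z * v - x * w * e₃ - y * e₂ * v + y * w * u + e₁ * e₂ * e₃ - e₁ * z * u = 0)
    (h2 : x * w - e₁ * e₂ = 0) (h3 : e₁ = 0) (h4 : e₂ = 0) (h5 : e₃ = 0) :
    w ^ 2 * y * u = 0 := by
  subst h3 h4 h5
  have key : w ^ 2 * y * u =
      w * (x * z * v - x * w * 0 - y * 0 * v + y * w * u + 0 * 0 * 0 - 0 * z * u)
      + (-(z * v)) * (x * w - 0 * 0) := by ring
  rw [key, h1, h2]
  ring

/-! ## §2 The five minors of the example, and its Γ-ideal -/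

section Example

variable (p : ℕ)

/-- The full `3 × 3` minor on the three `A`-columns is `det A`. [folklore] -/
theorem minor_ccc :
    ((Matrix.fromCols (1 : Matrix (Fin 3) (Fin 3) (MvPolynomial (Fin 3 × Fin 3) (ZMod p))) (Matrix.of fun i j => MvPolynomial.X (i, j))).submatrix id
        ![Sum.inr 0, Sum.inr 1, Sum.inr 2]).det =
      MvPolynomial.X (0,0) * MvPolynomial.X (1,1) * MvPolynomial.X (2,2) - MvPolynomial.X (0,0) * MvPolynomial.X (1,2) * MvPolynomial.X (2,1)
        - MvPolynomial.X (0,1) * MvPolynomial.X (1,0) * MvPolynomial.X (2,2) + MvPolynomial.X (0,1) * MvPolynomial.X (1,2) * MvPolynomial.X (2,0)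
        + MvPolynomial.X (0,2) * MvPolynomial.X (1,0) * MvPolynomial.X (2,1) - MvPolynomial.X (0,2) * MvPolynomial.X (1,1) * MvPolynomial.X (2,0) := by
  simp [Matrix.det_fin_three, Matrix.submatrix_apply, Matrix.fromCols_apply_inr]

/-- The minor on `(e₂, c₀, c₂)` is `a₀₀ a₁₂ - a₀₂ a₁₀`. [folklore] -/
theorem minor_e2c0c2 :
    ((Matrix.fromCols (1 : Matrix (Fin 3) (Fin 3) (MvPolynomial (Fin 3 × Fin 3) (ZMod p))) (Matrix.of fun i j => MvPolynomial.X (i, j))).submatrix id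
        ![Sum.inl 2, Sum.inr 0, Sum.inr 2]).det =
      MvPolynomial.X (0,0) * MvPolynomial.X (1,2) - MvPolynomial.X (0,2) * MvPolynomial.X (1,0) := by
  simp [Matrix.det_fin_three, Matrix.submatrix_apply, Matrix.fromCols_apply_inl,
    Matrix.fromCols_apply_inr]

/-- The minor on `(e₁, e₂, c₂)` is the entry `a₀₂`. [folklore] -/
theorem minor_e1e2c2 :
    ((Matrix.fromCols (1 : Matrix (Fin 3) (Fin 3) (MvPolynomial (Fin 3 × Fin 3) (ZMod p))) (Matrix.of fun i j => MvPolynomial.X (i, j))).submatrix id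
        ![Sum.inl 1, Sum.inl 2, Sum.inr 2]).det = MvPolynomial.X (0,2) := by
  simp [Matrix.det_fin_three, Matrix.submatrix_apply, Matrix.fromCols_apply_inl,
    Matrix.fromCols_apply_inr]

/-- The minor on `(e₀, e₂, c₀)` is `-a₁₀`. [folklore] -/
theorem minor_e0e2c0 :
    ((Matrix.fromCols (1 : Matrix (Fin 3) (Fin 3) (MvPolynomial (Fin 3 × Fin 3) (ZMod p))) (Matrix.of fun i j => MvPolynomial.X (i, j))).submatrix id
        ![Sum.inl 0, Sum.inl 2, Sum.inr 0]).det = - MvPolynomial.X (1,0) := by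
  simp [Matrix.det_fin_three, Matrix.submatrix_apply, Matrix.fromCols_apply_inl,
    Matrix.fromCols_apply_inr]

/-- The minor on `(e₀, e₁, c₁)` is the entry `a₂₁`. [folklore] -/
theorem minor_e0e1c1 :
    ((Matrix.fromCols (1 : Matrix (Fin 3) (Fin 3) (MvPolynomial (Fin 3 × Fin 3) (ZMod p))) (Matrix.of fun i j => MvPolynomial.X (i, j))).submatrix id
        ![Sum.inl 0, Sum.inl 1, Sum.inr 1]).det = MvPolynomial.X (2,1) := by
  simp [Matrix.det_fin_three, Matrix.submatrix_apply, Matrix.fromCols_apply_inl,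
    Matrix.fromCols_apply_inr]

/-- The Γ-ideal of the example, as the crux writes it, is the span of the five explicit polynomials.
[folklore] -/
theorem gammaIdeal_example_eq :
    Ideal.span ((fun u : Fin 3 → Fin 3 ⊕ Fin 3 => ((Matrix.fromCols (1 : Matrix (Fin 3) (Fin 3) (MvPolynomial (Fin 3 × Fin 3) (ZMod p))) (Matrix.of fun i j => MvPolynomial.X (i, j))).submatrix id u).det) ''
      ({![Sum.inr 0, Sum.inr 1, Sum.inr 2], ![Sum.inl 2, Sum.inr 0, Sum.inr 2],
        ![Sum.inl 1, Sum.inl 2, Sum.inr 2], ![Sum.inl 0, Sum.inl 2, Sum.inr 0],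
        ![Sum.inl 0, Sum.inl 1, Sum.inr 1]} : Set (Fin 3 → Fin 3 ⊕ Fin 3))) =
    Ideal.span {MvPolynomial.X (0,0) * MvPolynomial.X (1,1) * MvPolynomial.X (2,2) - MvPolynomial.X (0,0) * MvPolynomial.X (1,2) * MvPolynomial.X (2,1)
        - MvPolynomial.X (0,1) * MvPolynomial.X (1,0) * MvPolynomial.X (2,2) + MvPolynomial.X (0,1) * MvPolynomial.X (1,2) * MvPolynomial.X (2,0)
        + MvPolynomial.X (0,2) * MvPolynomial.X (1,0) * MvPolynomial.X (2,1) - MvPolynomial.X (0,2) * MvPolynomial.X (1,1) * MvPolynomial.X (2,0),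
      MvPolynomial.X (0,0) * MvPolynomial.X (1,2) - MvPolynomial.X (0,2) * MvPolynomial.X (1,0), MvPolynomial.X (0,2), - MvPolynomial.X (1,0), MvPolynomial.X (2,1)} := by
  simp only [Set.image_insert_eq, Set.image_singleton, minor_ccc, minor_e2c0c2, minor_e1e2c2,
    minor_e0e2c0, minor_e0e1c1]

/-! ## §3 Ring maps out of the stratum ring `S = (𝔽_p[A] ⧸ I)[(∏_∅)⁻¹]` -/

/-- A ring map `ψ : 𝔽_p[A] → T` killing the five generators factors through the stratum ring
(universal properties of quotient and localisation). [folklore] -/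
theorem exists_lift_stratumRing {T : Type} [CommRing T]
    (ψ : MvPolynomial (Fin 3 × Fin 3) (ZMod p) →+* T)
    (h1 : ψ (MvPolynomial.X (0,0) * MvPolynomial.X (1,1) * MvPolynomial.X (2,2) - MvPolynomial.X (0,0) * MvPolynomial.X (1,2) * MvPolynomial.X (2,1)
        - MvPolynomial.X (0,1) * MvPolynomial.X (1,0) * MvPolynomial.X (2,2) + MvPolynomial.X (0,1) * MvPolynomial.X (1,2) * MvPolynomial.X (2,0)
        + MvPolynomial.X (0,2) * MvPolynomial.X (1,0) * MvPolynomial.X (2,1) - MvPolynomial.X (0,2) * MvPolynomial.X (1,1) * MvPolynomial.X (2,0)) = 0)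
    (h2 : ψ (MvPolynomial.X (0,0) * MvPolynomial.X (1,2) - MvPolynomial.X (0,2) * MvPolynomial.X (1,0)) = 0)
    (h3 : ψ (MvPolynomial.X (0,2)) = 0) (h4 : ψ (MvPolynomial.X (1,0)) = 0) (h5 : ψ (MvPolynomial.X (2,1)) = 0) :
    ∃ φ : Localization.Away (Ideal.Quotient.mk (Ideal.span ((fun u : Fin 3 → Fin 3 ⊕ Fin 3 => ((Matrix.fromCols (1 : Matrix (Fin 3) (Fin 3) (MvPolynomial (Fin 3 × Fin 3) (ZMod p))) (Matrix.of fun i j => MvPolynomial.X (i, j))).submatrix id u).det) ''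
      ({![Sum.inr 0, Sum.inr 1, Sum.inr 2], ![Sum.inl 2, Sum.inr 0, Sum.inr 2],
        ![Sum.inl 1, Sum.inl 2, Sum.inr 2], ![Sum.inl 0, Sum.inl 2, Sum.inr 0],
        ![Sum.inl 0, Sum.inl 1, Sum.inr 1]} : Set (Fin 3 → Fin 3 ⊕ Fin 3))))
      (∏ u ∈ (∅ : Finset (Fin 3 → Fin 3 ⊕ Fin 3)), ((Matrix.fromCols (1 : Matrix (Fin 3) (Fin 3) (MvPolynomial (Fin 3 × Fin 3) (ZMod p))) (Matrix.of fun i j => MvPolynomial.X (i, j))).submatrix id u).det)) →+* T,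
      ∀ a, φ (algebraMap _ _ (Ideal.Quotient.mk (Ideal.span ((fun u : Fin 3 → Fin 3 ⊕ Fin 3 => ((Matrix.fromCols (1 : Matrix (Fin 3) (Fin 3) (MvPolynomial (Fin 3 × Fin 3) (ZMod p))) (Matrix.of fun i j => MvPolynomial.X (i, j))).submatrix id u).det) ''
      ({![Sum.inr 0, Sum.inr 1, Sum.inr 2], ![Sum.inl 2, Sum.inr 0, Sum.inr 2],
        ![Sum.inl 1, Sum.inl 2, Sum.inr 2], ![Sum.inl 0, Sum.inl 2, Sum.inr 0],
        ![Sum.inl 0, Sum.inl 1, Sum.inr 1]} : Set (Fin 3 → Fin 3 ⊕ Fin 3)))) a)) = ψ a := by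
  have hker : ∀ a ∈ Ideal.span ((fun u : Fin 3 → Fin 3 ⊕ Fin 3 => ((Matrix.fromCols (1 : Matrix (Fin 3) (Fin 3) (MvPolynomial (Fin 3 × Fin 3) (ZMod p))) (Matrix.of fun i j => MvPolynomial.X (i, j))).submatrix id u).det) ''
      ({![Sum.inr 0, Sum.inr 1, Sum.inr 2], ![Sum.inl 2, Sum.inr 0, Sum.inr 2],
        ![Sum.inl 1, Sum.inl 2, Sum.inr 2], ![Sum.inl 0, Sum.inl 2, Sum.inr 0],
        ![Sum.inl 0, Sum.inl 1, Sum.inr 1]} : Set (Fin 3 → Fin 3 ⊕ Fin 3))), ψ a = 0 := by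
    rw [gammaIdeal_example_eq]
    have hle : Ideal.span {MvPolynomial.X (0,0) * MvPolynomial.X (1,1) * MvPolynomial.X (2,2) - MvPolynomial.X (0,0) * MvPolynomial.X (1,2) * MvPolynomial.X (2,1)
        - MvPolynomial.X (0,1) * MvPolynomial.X (1,0) * MvPolynomial.X (2,2) + MvPolynomial.X (0,1) * MvPolynomial.X (1,2) * MvPolynomial.X (2,0)
        + MvPolynomial.X (0,2) * MvPolynomial.X (1,0) * MvPolynomial.X (2,1) - MvPolynomial.X (0,2) * MvPolynomial.X (1,1) * MvPolynomial.X (2,0),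
        MvPolynomial.X (0,0) * MvPolynomial.X (1,2) - MvPolynomial.X (0,2) * MvPolynomial.X (1,0), MvPolynomial.X (0,2), - MvPolynomial.X (1,0), MvPolynomial.X (2,1)} ≤
        RingHom.ker ψ := by
      refine Ideal.span_le.mpr ?_
      rintro a ha
      simp only [Set.mem_insert_iff, Set.mem_singleton_iff] at ha
      rcases ha with rfl | rfl | rfl | rfl | rfl <;> simp [RingHom.mem_ker, h1, h2, h3, h4, h5]
    exact fun a ha => hle ha
  have hunit : IsUnit (Ideal.Quotient.lift _ ψ hker (Ideal.Quotient.mk (Ideal.span ((fun u : Fin 3 → Fin 3 ⊕ Fin 3 => ((Matrix.fromCols (1 : Matrix (Fin 3) (Fin 3) (MvPolynomial (Fin 3 × Fin 3) (ZMod p))) (Matrix.of fun i j => MvPolynomial.X (i, j))).submatrix id u).det) ''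
      ({![Sum.inr 0, Sum.inr 1, Sum.inr 2], ![Sum.inl 2, Sum.inr 0, Sum.inr 2],
        ![Sum.inl 1, Sum.inl 2, Sum.inr 2], ![Sum.inl 0, Sum.inl 2, Sum.inr 0],
        ![Sum.inl 0, Sum.inl 1, Sum.inr 1]} : Set (Fin 3 → Fin 3 ⊕ Fin 3))))
      (∏ u ∈ (∅ : Finset (Fin 3 → Fin 3 ⊕ Fin 3)), ((Matrix.fromCols (1 : Matrix (Fin 3) (Fin 3) (MvPolynomial (Fin 3 × Fin 3) (ZMod p))) (Matrix.of fun i j => MvPolynomial.X (i, j))).submatrix id u).det))) := by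
    simp
  refine ⟨IsLocalization.Away.lift _ hunit, fun a => ?_⟩
  rw [IsLocalization.Away.lift_eq]
  simp

/-- Two ring maps out of the stratum ring that agree on (the images of) all polynomials are equal.
[folklore] -/
theorem ringHom_ext_stratumRing {T : Type} [CommRing T]
    (φ₁ φ₂ : Localization.Away (Ideal.Quotient.mk (Ideal.span ((fun u : Fin 3 → Fin 3 ⊕ Fin 3 => ((Matrix.fromCols (1 : Matrix (Fin 3) (Fin 3) (MvPolynomial (Fin 3 × Fin 3) (ZMod p))) (Matrix.of fun i j => MvPolynomial.X (i, j))).submatrix id u).det) ''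
      ({![Sum.inr 0, Sum.inr 1, Sum.inr 2], ![Sum.inl 2, Sum.inr 0, Sum.inr 2],
        ![Sum.inl 1, Sum.inl 2, Sum.inr 2], ![Sum.inl 0, Sum.inl 2, Sum.inr 0],
        ![Sum.inl 0, Sum.inl 1, Sum.inr 1]} : Set (Fin 3 → Fin 3 ⊕ Fin 3))))
      (∏ u ∈ (∅ : Finset (Fin 3 → Fin 3 ⊕ Fin 3)), ((Matrix.fromCols (1 : Matrix (Fin 3) (Fin 3) (MvPolynomial (Fin 3 × Fin 3) (ZMod p))) (Matrix.of fun i j => MvPolynomial.X (i, j))).submatrix id u).det)) →+* T)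
    (h : ∀ a, φ₁ (algebraMap _ _ (Ideal.Quotient.mk (Ideal.span ((fun u : Fin 3 → Fin 3 ⊕ Fin 3 => ((Matrix.fromCols (1 : Matrix (Fin 3) (Fin 3) (MvPolynomial (Fin 3 × Fin 3) (ZMod p))) (Matrix.of fun i j => MvPolynomial.X (i, j))).submatrix id u).det) ''
      ({![Sum.inr 0, Sum.inr 1, Sum.inr 2], ![Sum.inl 2, Sum.inr 0, Sum.inr 2],
        ![Sum.inl 1, Sum.inl 2, Sum.inr 2], ![Sum.inl 0, Sum.inl 2, Sum.inr 0],
        ![Sum.inl 0, Sum.inl 1, Sum.inr 1]} : Set (Fin 3 → Fin 3 ⊕ Fin 3)))) a)) =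
      φ₂ (algebraMap _ _ (Ideal.Quotient.mk (Ideal.span ((fun u : Fin 3 → Fin 3 ⊕ Fin 3 => ((Matrix.fromCols (1 : Matrix (Fin 3) (Fin 3) (MvPolynomial (Fin 3 × Fin 3) (ZMod p))) (Matrix.of fun i j => MvPolynomial.X (i, j))).submatrix id u).det) ''
      ({![Sum.inr 0, Sum.inr 1, Sum.inr 2], ![Sum.inl 2, Sum.inr 0, Sum.inr 2],
        ![Sum.inl 1, Sum.inl 2, Sum.inr 2], ![Sum.inl 0, Sum.inl 2, Sum.inr 0],
        ![Sum.inl 0, Sum.inl 1, Sum.inr 1]} : Set (Fin 3 → Fin 3 ⊕ Fin 3)))) a))) :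
    φ₁ = φ₂ := by
  apply IsLocalization.ringHom_ext (Submonoid.powers (Ideal.Quotient.mk (Ideal.span ((fun u : Fin 3 → Fin 3 ⊕ Fin 3 => ((Matrix.fromCols (1 : Matrix (Fin 3) (Fin 3) (MvPolynomial (Fin 3 × Fin 3) (ZMod p))) (Matrix.of fun i j => MvPolynomial.X (i, j))).submatrix id u).det) ''
      ({![Sum.inr 0, Sum.inr 1, Sum.inr 2], ![Sum.inl 2, Sum.inr 0, Sum.inr 2],
        ![Sum.inl 1, Sum.inl 2, Sum.inr 2], ![Sum.inl 0, Sum.inl 2, Sum.inr 0],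
        ![Sum.inl 0, Sum.inl 1, Sum.inr 1]} : Set (Fin 3 → Fin 3 ⊕ Fin 3))))
    (∏ u ∈ (∅ : Finset (Fin 3 → Fin 3 ⊕ Fin 3)), ((Matrix.fromCols (1 : Matrix (Fin 3) (Fin 3) (MvPolynomial (Fin 3 × Fin 3) (ZMod p))) (Matrix.of fun i j => MvPolynomial.X (i, j))).submatrix id u).det)))
  apply Ideal.Quotient.ringHom_ext
  exact RingHom.ext h

/-! ## §4 The tangent-vector argument, for any presentation -/

/-- **Key algebraic statement.** Let `ι : 𝔽_p[A] → S` kill the five minors and let every such map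
factor through `ι` (`hlift`) uniquely (`hext`). Then (i) `ι(y w u)` is nilpotent; (ii) the basic open
`D(ι(y u z v))` of `Spec S` is non-empty (the `𝔽_p`-point `y = u = z = v = 1`, all other entries
`0`); (iii) for every prime `𝔮 ∌ ι(y u z v)`, `s · ι(y w u) = 0 ⇒ s ∈ 𝔮`: apply the tangent vector
`S → (S ⧸ 𝔮)[ε]` (`x ↦ ȳū ε`, `w ↦ -z̄v̄ ε`, `y, z, u, v ↦ ȳ, z̄, ū, v̄`, `e₁, e₂, e₃ ↦ 0`), which
lies over `S → S ⧸ 𝔮` since `x, w ∈ 𝔮` (`x_sq_zv_eq_zero`, `w_sq_yu_eq_zero`), and read off the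
`ε`-coefficient `s̄ · (-ȳz̄v̄ū) = 0` in the domain `S ⧸ 𝔮`. [folklore] -/
theorem key_of_presentation [Fact p.Prime] {S : Type} [CommRing S]
    (ι : MvPolynomial (Fin 3 × Fin 3) (ZMod p) →+* S)
    (h1 : ι (MvPolynomial.X (0,0) * MvPolynomial.X (1,1) * MvPolynomial.X (2,2) - MvPolynomial.X (0,0) * MvPolynomial.X (1,2) * MvPolynomial.X (2,1)
        - MvPolynomial.X (0,1) * MvPolynomial.X (1,0) * MvPolynomial.X (2,2) + MvPolynomial.X (0,1) * MvPolynomial.X (1,2) * MvPolynomial.X (2,0)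
        + MvPolynomial.X (0,2) * MvPolynomial.X (1,0) * MvPolynomial.X (2,1) - MvPolynomial.X (0,2) * MvPolynomial.X (1,1) * MvPolynomial.X (2,0)) = 0)
    (h2 : ι (MvPolynomial.X (0,0) * MvPolynomial.X (1,2) - MvPolynomial.X (0,2) * MvPolynomial.X (1,0)) = 0)
    (h3 : ι (MvPolynomial.X (0,2)) = 0) (h4 : ι (MvPolynomial.X (1,0)) = 0) (h5 : ι (MvPolynomial.X (2,1)) = 0)
    (hlift : ∀ (T : Type) [CommRing T] (ψ : MvPolynomial (Fin 3 × Fin 3) (ZMod p) →+* T),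
      ψ (MvPolynomial.X (0,0) * MvPolynomial.X (1,1) * MvPolynomial.X (2,2) - MvPolynomial.X (0,0) * MvPolynomial.X (1,2) * MvPolynomial.X (2,1)
        - MvPolynomial.X (0,1) * MvPolynomial.X (1,0) * MvPolynomial.X (2,2) + MvPolynomial.X (0,1) * MvPolynomial.X (1,2) * MvPolynomial.X (2,0)
        + MvPolynomial.X (0,2) * MvPolynomial.X (1,0) * MvPolynomial.X (2,1) - MvPolynomial.X (0,2) * MvPolynomial.X (1,1) * MvPolynomial.X (2,0)) = 0 →
      ψ (MvPolynomial.X (0,0) * MvPolynomial.X (1,2) - MvPolynomial.X (0,2) * MvPolynomial.X (1,0)) = 0 →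
      ψ (MvPolynomial.X (0,2)) = 0 → ψ (MvPolynomial.X (1,0)) = 0 → ψ (MvPolynomial.X (2,1)) = 0 →
      ∃ φ : S →+* T, ∀ a, φ (ι a) = ψ a)
    (hext : ∀ (T : Type) [CommRing T] (φ₁ φ₂ : S →+* T), (∀ a, φ₁ (ι a) = φ₂ (ι a)) → φ₁ = φ₂) :
    IsNilpotent (ι (MvPolynomial.X (0,1) * MvPolynomial.X (1,2) * MvPolynomial.X (2,0))) ∧
    (PrimeSpectrum.basicOpen (ι (MvPolynomial.X (0,1) * MvPolynomial.X (2,0) * MvPolynomial.X (1,1) * MvPolynomial.X (2,2))) :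
        Set (PrimeSpectrum S)).Nonempty ∧
    ∀ q : PrimeSpectrum S, ι (MvPolynomial.X (0,1) * MvPolynomial.X (2,0) * MvPolynomial.X (1,1) * MvPolynomial.X (2,2)) ∉ q.asIdeal →
      ∀ s : S, s * ι (MvPolynomial.X (0,1) * MvPolynomial.X (1,2) * MvPolynomial.X (2,0)) = 0 → s ∈ q.asIdeal := by
  -- the five relations among the images `ι(a_ij)`
  have r1 : ι (MvPolynomial.X (0,0)) * ι (MvPolynomial.X (1,1)) * ι (MvPolynomial.X (2,2))
      - ι (MvPolynomial.X (0,0)) * ι (MvPolynomial.X (1,2)) * ι (MvPolynomial.X (2,1))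
      - ι (MvPolynomial.X (0,1)) * ι (MvPolynomial.X (1,0)) * ι (MvPolynomial.X (2,2))
      + ι (MvPolynomial.X (0,1)) * ι (MvPolynomial.X (1,2)) * ι (MvPolynomial.X (2,0))
      + ι (MvPolynomial.X (0,2)) * ι (MvPolynomial.X (1,0)) * ι (MvPolynomial.X (2,1))
      - ι (MvPolynomial.X (0,2)) * ι (MvPolynomial.X (1,1)) * ι (MvPolynomial.X (2,0)) = 0 := by
    simpa only [map_sub, map_add, map_mul] using h1
  have r2 : ι (MvPolynomial.X (0,0)) * ι (MvPolynomial.X (1,2)) - ι (MvPolynomial.X (0,2)) * ι (MvPolynomial.X (1,0)) = 0 := by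
    simpa only [map_sub, map_mul] using h2
  refine ⟨⟨2, ?_⟩, ?_, ?_⟩
  · rw [map_mul, map_mul]
    exact ywu_sq_eq_zero _ _ _ _ _ _ _ _ _ r1 r2 h3 h4 h5
  · -- the `𝔽_p`-point `a₀₁ = a₂₀ = a₁₁ = a₂₂ = 1`, all other entries `0`
    obtain ⟨φ₀, hφ₀⟩ := hlift (ZMod p)
      (MvPolynomial.eval fun ij : Fin 3 × Fin 3 =>
        if ij = (0,1) ∨ ij = (2,0) ∨ ij = (1,1) ∨ ij = (2,2) then (1 : ZMod p) else 0)
      (by simp) (by simp) (by simp) (by simp) (by simp)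
    refine ⟨⟨RingHom.ker φ₀, RingHom.ker_isPrime φ₀⟩, ?_⟩
    show ι _ ∉ RingHom.ker φ₀
    rw [RingHom.mem_ker, hφ₀]
    simp
  · intro q hgq s hs
    haveI : q.asIdeal.IsPrime := q.isPrime
    haveI : IsDomain (S ⧸ q.asIdeal) := Ideal.Quotient.isDomain q.asIdeal
    let π : S →+* S ⧸ q.asIdeal := Ideal.Quotient.mk q.asIdeal
    let yb : S ⧸ q.asIdeal := π (ι (MvPolynomial.X (0,1)))
    let ub : S ⧸ q.asIdeal := π (ι (MvPolynomial.X (2,0)))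
    let zb : S ⧸ q.asIdeal := π (ι (MvPolynomial.X (1,1)))
    let vb : S ⧸ q.asIdeal := π (ι (MvPolynomial.X (2,2)))
    -- (a) the four factors of `g` are non-zero in `S ⧸ 𝔮`
    have hg_fac : ∀ ij : Fin 3 × Fin 3, ij = (0,1) ∨ ij = (2,0) ∨ ij = (1,1) ∨ ij = (2,2) →
        π (ι (MvPolynomial.X ij)) ≠ 0 := by
      intro ij hij h0
      apply hgq
      have hmem : ι (MvPolynomial.X ij) ∈ q.asIdeal := Ideal.Quotient.eq_zero_iff_mem.mp h0
      have hsplit : ι (MvPolynomial.X (0,1) * MvPolynomial.X (2,0) * MvPolynomial.X (1,1) * MvPolynomial.X (2,2)) =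
          ι (MvPolynomial.X (0,1)) * ι (MvPolynomial.X (2,0)) * ι (MvPolynomial.X (1,1)) * ι (MvPolynomial.X (2,2)) := by
        simp only [map_mul]
      rw [hsplit]
      rcases hij with rfl | rfl | rfl | rfl
      · exact Ideal.mul_mem_right _ _ (Ideal.mul_mem_right _ _ (Ideal.mul_mem_right _ _ hmem))
      · exact Ideal.mul_mem_right _ _ (Ideal.mul_mem_right _ _ (Ideal.mul_mem_left _ _ hmem))
      · exact Ideal.mul_mem_right _ _ (Ideal.mul_mem_left _ _ hmem)
      · exact Ideal.mul_mem_left _ _ hmem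
    -- (b) `x, w ∈ 𝔮` and `e₁ = e₂ = e₃ = 0`
    have hx : ι (MvPolynomial.X (0,0)) ∈ q.asIdeal := by
      have h0 : ι (MvPolynomial.X (0,0)) ^ 2 * ι (MvPolynomial.X (1,1)) * ι (MvPolynomial.X (2,2)) ∈ q.asIdeal := by
        rw [x_sq_zv_eq_zero _ _ _ _ _ _ _ _ _ r1 r2 h3 h4 h5]
        exact q.asIdeal.zero_mem
      rcases q.isPrime.mem_or_mem h0 with k1 | k1
      · rcases q.isPrime.mem_or_mem k1 with k2 | k2
        · exact q.isPrime.mem_of_pow_mem 2 k2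
        · exact absurd (Ideal.Quotient.eq_zero_iff_mem.mpr k2) (hg_fac (1,1) (by simp))
      · exact absurd (Ideal.Quotient.eq_zero_iff_mem.mpr k1) (hg_fac (2,2) (by simp))
    have hw : ι (MvPolynomial.X (1,2)) ∈ q.asIdeal := by
      have h0 : ι (MvPolynomial.X (1,2)) ^ 2 * ι (MvPolynomial.X (0,1)) * ι (MvPolynomial.X (2,0)) ∈ q.asIdeal := by
        rw [w_sq_yu_eq_zero _ _ _ _ _ _ _ _ _ r1 r2 h3 h4 h5]
        exact q.asIdeal.zero_mem
      rcases q.isPrime.mem_or_mem h0 with k1 | k1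
      · rcases q.isPrime.mem_or_mem k1 with k2 | k2
        · exact q.isPrime.mem_of_pow_mem 2 k2
        · exact absurd (Ideal.Quotient.eq_zero_iff_mem.mpr k2) (hg_fac (0,1) (by simp))
      · exact absurd (Ideal.Quotient.eq_zero_iff_mem.mpr k1) (hg_fac (2,0) (by simp))
    -- (c) the tangent vector `S → (S ⧸ 𝔮)[ε]`
    let val : Fin 3 × Fin 3 → TrivSqZeroExt (S ⧸ q.asIdeal) (S ⧸ q.asIdeal) := fun ij =>
      (![![TrivSqZeroExt.inr (yb * ub), TrivSqZeroExt.inl yb, 0],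
         ![0, TrivSqZeroExt.inl zb, TrivSqZeroExt.inr (-(zb * vb))],
         ![TrivSqZeroExt.inl ub, 0, TrivSqZeroExt.inl vb]] :
          Fin 3 → Fin 3 → TrivSqZeroExt (S ⧸ q.asIdeal) (S ⧸ q.asIdeal)) ij.1 ij.2
    let θ : ZMod p →+* TrivSqZeroExt (S ⧸ q.asIdeal) (S ⧸ q.asIdeal) :=
      (algebraMap (S ⧸ q.asIdeal) _).comp (π.comp (ι.comp MvPolynomial.C))
    let ψ : MvPolynomial (Fin 3 × Fin 3) (ZMod p) →+* TrivSqZeroExt (S ⧸ q.asIdeal) (S ⧸ q.asIdeal) :=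
      MvPolynomial.eval₂Hom θ val
    have hψX : ∀ ij, ψ (MvPolynomial.X ij) = val ij := fun ij => MvPolynomial.eval₂Hom_X' θ val ij
    have k3 : ψ (MvPolynomial.X (0,2)) = 0 := by rw [hψX]; simp [val]
    have k4 : ψ (MvPolynomial.X (1,0)) = 0 := by rw [hψX]; simp [val]
    have k5 : ψ (MvPolynomial.X (2,1)) = 0 := by rw [hψX]; simp [val]
    have k2 : ψ (MvPolynomial.X (0,0) * MvPolynomial.X (1,2) - MvPolynomial.X (0,2) * MvPolynomial.X (1,0)) = 0 := by
      simp only [map_sub, map_mul, hψX]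
      simp [val]
    have k1 : ψ (MvPolynomial.X (0,0) * MvPolynomial.X (1,1) * MvPolynomial.X (2,2) - MvPolynomial.X (0,0) * MvPolynomial.X (1,2) * MvPolynomial.X (2,1)
        - MvPolynomial.X (0,1) * MvPolynomial.X (1,0) * MvPolynomial.X (2,2) + MvPolynomial.X (0,1) * MvPolynomial.X (1,2) * MvPolynomial.X (2,0)
        + MvPolynomial.X (0,2) * MvPolynomial.X (1,0) * MvPolynomial.X (2,1) - MvPolynomial.X (0,2) * MvPolynomial.X (1,1) * MvPolynomial.X (2,0)) = 0 := by
      simp only [map_sub, map_add, map_mul, hψX]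
      simp only [val, Matrix.cons_val_zero, Matrix.cons_val_one, Matrix.head_cons,
        Matrix.cons_val_two, Matrix.tail_cons]
      ext <;> simp [TrivSqZeroExt.fst_mul, TrivSqZeroExt.snd_mul]
      ring
    obtain ⟨φ, hφι⟩ := hlift _ ψ k1 k2 k3 k4 k5
    -- (d) the tangent vector lies over `S → S ⧸ 𝔮`
    have hfst : ∀ t : S, (φ t).fst = π t := by
      suffices h : (TrivSqZeroExt.fstHom (S ⧸ q.asIdeal) (S ⧸ q.asIdeal)
          (S ⧸ q.asIdeal)).toRingHom.comp φ = π from fun t => RingHom.congr_fun h t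
      apply hext
      intro a
      show (φ (ι a)).fst = π (ι a)
      rw [hφι]
      revert a
      suffices h : (TrivSqZeroExt.fstHom (S ⧸ q.asIdeal) (S ⧸ q.asIdeal)
          (S ⧸ q.asIdeal)).toRingHom.comp ψ = π.comp ι from fun a => RingHom.congr_fun h a
      apply MvPolynomial.ringHom_ext
      · intro c
        show (ψ (MvPolynomial.C c)).fst = π (ι (MvPolynomial.C c))
        rw [MvPolynomial.eval₂Hom_C]
        simp [θ, TrivSqZeroExt.algebraMap_eq_inl]
      · intro ij
        show (ψ (MvPolynomial.X ij)).fst = π (ι (MvPolynomial.X ij))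
        rw [hψX]
        rcases ij with ⟨i, j⟩
        fin_cases i <;> fin_cases j <;>
          simp [val, yb, ub, zb, vb, Ideal.Quotient.eq_zero_iff_mem.mpr hx,
            Ideal.Quotient.eq_zero_iff_mem.mpr hw, h3, h4, h5, π]
    -- (e) apply the tangent vector to `s * f = 0` and read off the `ε`-coefficient
    have hφf : φ (ι (MvPolynomial.X (0,1) * MvPolynomial.X (1,2) * MvPolynomial.X (2,0))) =
        TrivSqZeroExt.inr (-(yb * (zb * vb) * ub)) := by
      rw [hφι]
      simp only [map_mul, hψX]
      simp only [val, Matrix.cons_val_zero, Matrix.cons_val_one, Matrix.head_cons,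
        Matrix.cons_val_two, Matrix.tail_cons]
      ext <;> simp [TrivSqZeroExt.fst_mul, TrivSqZeroExt.snd_mul]
      ring
    have hsf : (φ s * φ (ι (MvPolynomial.X (0,1) * MvPolynomial.X (1,2) * MvPolynomial.X (2,0)))).snd = 0 := by
      have h := congrArg (fun t => (φ t).snd) hs
      simpa only [map_mul φ s, map_zero, TrivSqZeroExt.snd_zero] using h
    rw [hφf, TrivSqZeroExt.snd_mul, hfst s] at hsf
    simp only [TrivSqZeroExt.snd_inr, TrivSqZeroExt.fst_inr, MulOpposite.op_zero, zero_smul,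
      add_zero, smul_eq_mul] at hsf
    have hc : (-(yb * (zb * vb) * ub) : S ⧸ q.asIdeal) ≠ 0 := by
      rw [neg_ne_zero]
      exact mul_ne_zero (mul_ne_zero (hg_fac (0,1) (by simp))
        (mul_ne_zero (hg_fac (1,1) (by simp)) (hg_fac (2,2) (by simp)))) (hg_fac (2,0) (by simp))
    have hπs : π s = 0 := (mul_eq_zero.mp hsf).resolve_right hc
    exact Ideal.Quotient.eq_zero_iff_mem.mp hπs

end Example

end Summit.ResolutionOfSingularities.ResolutionOfSingularities.Theorems.MatroidCellRes.Negative

end
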